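import Mathlib.Analysis.MellinTransform
import Mathlib.Analysis.SpecialFunctions.Gamma.Deriv
import Mathlib.Analysis.SpecialFunctions.Gamma.Beta
import Mathlib.Analysis.SpecialFunctions.Pow.Deriv
import Mathlib.Analysis.SpecialFunctions.Pow.Asymptotics
import Mathlib.MeasureTheory.Integral.IntegralEqImproper
import Literature.Probability.Distributions.HermiteGaussian
import Literature.NumberTheory.LFunctions.LocalRiemannHypothesis
import HarnessLib

/-!
# The local Riemann hypothesis (archimedean place): the Mellin transforms of the Hermite functions

Analytic half of [cite: BumpEtAl2000, Thm 1] / [cite: Srednicki2011, §2], complementing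
`Literature/NumberTheory/LFunctions/LocalRiemannHypothesis.lean` (the Jacobi-recursion argument).

With Mathlib's probabilists' Hermite polynomials `He_n` (`Literature.Probability.Distributions.hermiteR`)
the oscillator eigenfunctions are `ψ_n(x) = He_n(x) e^{-x²/4}` and their Mellin transforms are
`Φ_n(s) = ∫₀^∞ ψ_n(x) x^{s-1} dx` (`hermiteMellin n s = mellin ψ_n s`), convergent for `Re s > 0`.
We prove, for `Re s > 0`:

* `mellin_gaussPoly_deriv` — integration by parts `M[f'](s+1) = -s·M[f](s)` for
  `f = P·e^{-x²/4}` (`P` any real polynomial), i.e. Srednicki's "`H_BK = -i(x d/dx + 1/2)` acts on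
  the Mellin side as multiplication by `E`" [cite: Srednicki2011, §2, eq. for E⟨k|E,δ⟩];
* `hermiteR_add_two_ladder` — the polynomial ladder identity
  `He_{n+2} = X²·He_n − 2X·He_n' − He_n + He_n''` (two applications of `He_{m+1} = X He_m − He_m'`),
  the coordinate form of `(xp+px)/2 = (i/2)(a†a† − aa)` [cite: Srednicki2011, §2, eq. for ⟨n|H|n'⟩];
* `hermiteMellin_add_two` — the parity-preserving recursion
  `Φ_{n+2}(s) = (2s−1)·Φ_n(s) + M[He_n''·e^{-x²/4}](s)`, with `He_{m+2}'' = (m+2)(m+1)He_m`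
  (`hermiteMellin_add_four`) and `He_0'' = He_1'' = 0` (`hermiteMellin_two`, `hermiteMellin_three`);
* `hermiteMellin_zero`, `hermiteMellin_one` — `Φ_0(s) = ½·(¼)^{-s/2}·Γ(s/2)`, `Φ_1(s) = Φ_0(s+1)`,
  both non-zero for `Re s > 0` (the Tate local factors `Γ_{∞,δ}`).

Assembly (`hermiteMellin_eq_hermiteMellinPoly_mul`): `Φ_{2K+δ}(s) = Q_K(s)·Φ_δ(s)` (`δ ∈ {0,1}`,
`Re s > 0`) with the integer polynomials `Q_K = hermiteMellinPoly δ K` of the companion file; hence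
(`hermiteMellin_eq_zero_iff`) `Φ_n(s) = 0 ↔ Q_{⌊n/2⌋}^{(n mod 2)}(s) = 0`, and the
**local Riemann hypothesis on the Mellin side** (`re_eq_half_of_hermiteMellin_eq_zero`): every zero
of `Φ_n` in the half-plane of convergence `Re s > 0` lies on `Re s = 1/2`
[cite: BumpEtAl2000, Thm 1], the zeros being `s = 1/2 + iE` with `E` an eigenvalue of the
compressed Berry–Keating Hamiltonian [cite: Srednicki2011, §2].

Not here: the meromorphic continuation of `Φ_n` to `Re s ≤ 0` (where `Φ_n = Q·Φ_δ` continues to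
hold and `Φ_δ` has the poles of `Γ((s+δ)/2)` and no zeros), the `p`-adic case, general `α`.
-/

namespace Literature.NumberTheory.LFunctions

open Polynomial Complex Filter Asymptotics Set
open _root_.MeasureTheory _root_.Real
open scoped _root_.Topology
open Literature.Probability.Distributions (hermiteR hermiteR_zero hermiteR_succ derivative_hermiteR_succ)

namespace LocalRH

noncomputable section

/-! ### Polynomial × Gaussian functions and their calculus -/

/-- `gaussPoly P x = P(x)·e^{-x²/4}`. [cite: Srednicki2011, §2, ψ_{∞,N}] -/
def gaussPoly (P : ℝ[X]) (x : ℝ) : ℝ := P.eval x * Real.exp (-x ^ 2 / 4)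

/-- The `n`-th oscillator eigenfunction in the probabilists' normalisation,
`ψ_n(x) = He_n(x) e^{-x²/4}`. [cite: Srednicki2011, §2, ψ_{∞,N}] -/
def hermiteFun (n : ℕ) : ℝ → ℝ := gaussPoly (hermiteR n)

/-- The Mellin transform `Φ_n(s) = ∫₀^∞ ψ_n(x) x^{s-1} dx` (BCKV's `M_n(s)` up to the normalisation
of `f_n`). [cite: BumpEtAl2000, §1, M_n(s)] -/
def hermiteMellin (n : ℕ) (s : ℂ) : ℂ := mellin (fun x => (hermiteFun n x : ℂ)) s

/-- The derivative polynomial: `(P·e^{-x²/4})' = (P' − (X/2)·P)·e^{-x²/4}`. [folklore] -/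
def derivPoly (P : ℝ[X]) : ℝ[X] := derivative P - C (1 / 2 : ℝ) * X * P

/-- `d/dx (P(x) e^{-x²/4}) = (P'(x) − x P(x)/2) e^{-x²/4}`. [folklore] -/
private theorem hasDerivAt_gaussPoly (P : ℝ[X]) (x : ℝ) :
    HasDerivAt (gaussPoly P) (gaussPoly (derivPoly P) x) x := by
  have h1 : HasDerivAt (fun x : ℝ => -x ^ 2 / 4) (-(2 * x) / 4) x := by
    have := ((hasDerivAt_pow 2 x).neg).div_const 4
    simpa using this
  have h2 := (P.hasDerivAt x).mul h1.exp
  have e : gaussPoly (derivPoly P) x = eval x (derivative P) * Real.exp (-x ^ 2 / 4) +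
      eval x P * (Real.exp (-x ^ 2 / 4) * (-(2 * x) / 4)) := by
    simp only [gaussPoly, derivPoly, eval_sub, eval_mul, eval_C, eval_X]
    ring
  rw [e]
  exact h2

/-- `gaussPoly` is continuous. [folklore] -/
private theorem continuous_gaussPoly (P : ℝ[X]) : Continuous (gaussPoly P) :=
  P.continuous.mul (by fun_prop)

/-- `e^{-x²/4} ≤ e·e^{-x}` (from `(x-2)² ≥ 0`). [folklore] -/
private theorem exp_neg_sq_le (x : ℝ) : Real.exp (-x ^ 2 / 4) ≤ Real.exp 1 * Real.exp (-x) := by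
  rw [← Real.exp_add]
  exact Real.exp_le_exp.mpr (by nlinarith [sq_nonneg (x - 2)])

/-- `P(x)·x^r·e^{-bx} → 0` as `x → ∞` (`b > 0`). [folklore] -/
private theorem tendsto_eval_mul_rpow_mul_exp (P : ℝ[X]) (r b : ℝ) (hb : 0 < b) :
    Tendsto (fun x => P.eval x * x ^ r * Real.exp (-b * x)) atTop (𝓝 0) := by
  have hsum : ∀ x : ℝ, 0 < x → P.eval x * x ^ r * Real.exp (-b * x) =
      ∑ i ∈ Finset.range (P.natDegree + 1), P.coeff i * (x ^ ((i : ℝ) + r) * Real.exp (-b * x)) := by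
    intro x hx
    rw [eval_eq_sum_range, Finset.sum_mul, Finset.sum_mul]
    refine Finset.sum_congr rfl fun i _ => ?_
    rw [Real.rpow_add hx, Real.rpow_natCast]
    ring
  have hlim : Tendsto (fun x => ∑ i ∈ Finset.range (P.natDegree + 1),
      P.coeff i * (x ^ ((i : ℝ) + r) * Real.exp (-b * x))) atTop (𝓝 0) := by
    have : (0 : ℝ) = ∑ i ∈ Finset.range (P.natDegree + 1), P.coeff i * 0 := by simp
    rw [this]
    refine tendsto_finsetSum _ fun i _ => ?_
    exact (tendsto_rpow_mul_exp_neg_mul_atTop_nhds_zero _ _ hb).const_mul _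
  refine hlim.congr' ?_
  filter_upwards [eventually_gt_atTop 0] with x hx
  exact (hsum x hx).symm

/-- `gaussPoly P = O(e^{-x/2})` at `+∞`. [folklore] -/
private theorem gaussPoly_isBigO_exp (P : ℝ[X]) :
    (fun x => (gaussPoly P x : ℂ)) =O[atTop] fun x => Real.exp (-(1 / 2) * x) := by
  have ht : Tendsto (fun x => |P.eval x * Real.exp (-(1 / 2) * x)|) atTop (𝓝 0) := by
    have := (tendsto_eval_mul_rpow_mul_exp P 0 (1 / 2) (by norm_num)).abs
    simpa [Real.rpow_zero] using this
  have hev : ∀ᶠ x in atTop, |P.eval x * Real.exp (-(1 / 2) * x)| ≤ 1 :=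
    ht.eventually (eventually_le_nhds one_pos)
  refine IsBigO.of_bound (Real.exp 1) ?_
  filter_upwards [hev, eventually_gt_atTop 0] with x hx hx0
  rw [Complex.norm_real, Real.norm_eq_abs, Real.norm_eq_abs, abs_of_pos (Real.exp_pos _)]
  unfold gaussPoly
  rw [abs_mul, abs_of_pos (Real.exp_pos _)]
  have h1 : |P.eval x| * Real.exp (-(1 / 2) * x) ≤ 1 := by
    simpa [abs_mul, abs_of_pos (Real.exp_pos _)] using hx
  calc |P.eval x| * Real.exp (-x ^ 2 / 4)
      ≤ |P.eval x| * (Real.exp 1 * Real.exp (-x)) :=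
        mul_le_mul_of_nonneg_left (exp_neg_sq_le x) (abs_nonneg _)
    _ = (|P.eval x| * Real.exp (-(1 / 2) * x)) * (Real.exp 1 * Real.exp (-(1 / 2) * x)) := by
        rw [show -x = -(1 / 2) * x + -(1 / 2) * x by ring, Real.exp_add]; ring
    _ ≤ 1 * (Real.exp 1 * Real.exp (-(1 / 2) * x)) :=
        mul_le_mul_of_nonneg_right h1 (by positivity)
    _ = Real.exp 1 * Real.exp (-(1 / 2) * x) := one_mul _

/-- The Mellin integral of `P(x)e^{-x²/4}` converges for `Re s > 0`. [cite: BumpEtAl2000, §1] -/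
theorem mellinConvergent_gaussPoly (P : ℝ[X]) {s : ℂ} (hs : 0 < s.re) :
    MellinConvergent (fun x => (gaussPoly P x : ℂ)) s := by
  refine mellinConvergent_of_isBigO_rpow_exp (b := 0) (by norm_num : (0:ℝ) < 1 / 2) ?_
    (gaussPoly_isBigO_exp P) ?_ hs
  · exact (Complex.continuous_ofReal.comp (continuous_gaussPoly P)).continuousOn.locallyIntegrableOn
      measurableSet_Ioi
  · have hc : Tendsto (fun x => (gaussPoly P x : ℂ)) (𝓝[>] 0) (𝓝 (gaussPoly P 0 : ℂ)) :=
      ((Complex.continuous_ofReal.comp (continuous_gaussPoly P)).tendsto 0).mono_left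
        nhdsWithin_le_nhds
    have h1 := hc.isBigO_one ℝ
    refine h1.trans ?_
    refine (isBigO_refl (fun _ : ℝ => (1 : ℝ)) _).congr' EventuallyEq.rfl ?_
    filter_upwards with x
    simp

/-- The boundary term `P(x)e^{-x²/4}·x^s → 0` as `x → ∞`. [folklore] -/
private theorem tendsto_gaussPoly_mul_cpow (P : ℝ[X]) (s : ℂ) :
    Tendsto (fun x : ℝ => (gaussPoly P x : ℂ) * (x : ℂ) ^ s) atTop (𝓝 0) := by
  refine squeeze_zero_norm' (a := fun x => Real.exp 1 * |P.eval x * x ^ s.re * Real.exp (-1 * x)|) ?_ ?_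
  · filter_upwards [eventually_gt_atTop 0] with x hx
    rw [norm_mul, Complex.norm_cpow_eq_rpow_re_of_pos hx, Complex.norm_real, Real.norm_eq_abs]
    unfold gaussPoly
    rw [abs_mul, abs_of_pos (Real.exp_pos _), abs_mul, abs_mul, abs_of_pos (Real.exp_pos _),
      abs_of_pos (Real.rpow_pos_of_pos hx _)]
    calc |P.eval x| * Real.exp (-x ^ 2 / 4) * x ^ s.re
        ≤ |P.eval x| * (Real.exp 1 * Real.exp (-x)) * x ^ s.re := by
          gcongr; exact exp_neg_sq_le x
      _ = Real.exp 1 * (|P.eval x| * x ^ s.re * Real.exp (-1 * x)) := by ring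
  · have := ((tendsto_eval_mul_rpow_mul_exp P s.re 1 one_pos).abs).const_mul (Real.exp 1)
    simpa using this

/-- **Integration by parts on the Mellin side** (`M[f'](s+1) = -s·M[f](s)`, `Re s > 0`) for
`f = P·e^{-x²/4}`: the Mellin transform intertwines `x d/dx` with multiplication by `-s`, i.e.
Srednicki's `E⟨k|E,δ⟩ = ⟨k|H_BK|E,δ⟩`. [cite: Srednicki2011, §2] -/
theorem mellin_gaussPoly_deriv (P : ℝ[X]) {s : ℂ} (hs : 0 < s.re) :
    mellin (fun x => (gaussPoly (derivPoly P) x : ℂ)) (s + 1) =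
      -s * mellin (fun x => (gaussPoly P x : ℂ)) s := by
  have hs0 : s ≠ 0 := fun h => by simp [h] at hs
  -- g(x) = f(x)·x^s, g' = f'·x^s + f·s·x^{s-1}
  set g : ℝ → ℂ := fun x => (gaussPoly P x : ℂ) * (x : ℂ) ^ s with hg
  set g' : ℝ → ℂ := fun x => (gaussPoly (derivPoly P) x : ℂ) * (x : ℂ) ^ s +
    (gaussPoly P x : ℂ) * (s * (x : ℂ) ^ (s - 1)) with hg'
  have hderiv : ∀ x ∈ Ioi (0:ℝ), HasDerivAt g (g' x) x := by
    intro x hx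
    have h1 : HasDerivAt (fun y : ℝ => (gaussPoly P y : ℂ)) (gaussPoly (derivPoly P) x : ℂ) x :=
      (hasDerivAt_gaussPoly P x).ofReal_comp
    have h2 : HasDerivAt (fun y : ℝ => (y : ℂ) ^ s) (s * (x : ℂ) ^ (s - 1)) x := by
      have := (Complex.hasStrictDerivAt_cpow_const (x := (x : ℂ)) (c := s)
        (Or.inl (by simpa using hx))).hasDerivAt
      exact this.comp_ofReal
    exact h1.mul h2
  have hcont : ContinuousWithinAt g (Ici 0) 0 := by
    refine ContinuousAt.continuousWithinAt ?_
    exact ((Complex.continuous_ofReal.comp (continuous_gaussPoly P)).continuousAt).mul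
      (Complex.continuousAt_ofReal_cpow_const 0 s (Or.inl hs))
  have hint1 : IntegrableOn (fun x : ℝ => (gaussPoly (derivPoly P) x : ℂ) * (x : ℂ) ^ s) (Ioi 0) := by
    have h := mellinConvergent_gaussPoly (derivPoly P) (s := s + 1) (by simp; linarith)
    refine (integrableOn_congr_fun (fun x _ => ?_) measurableSet_Ioi).mp h
    simp [smul_eq_mul, mul_comm]
  have hint2 : IntegrableOn (fun x : ℝ => (gaussPoly P x : ℂ) * (s * (x : ℂ) ^ (s - 1))) (Ioi 0) := by
    have h := (mellinConvergent_gaussPoly P hs).const_smul s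
    refine (integrableOn_congr_fun (fun x _ => ?_) measurableSet_Ioi).mp h
    simp [smul_eq_mul]; ring
  have hint : IntegrableOn g' (Ioi 0) := hint1.add hint2
  have hFTC := integral_Ioi_of_hasDerivAt_of_tendsto hcont hderiv hint
    (tendsto_gaussPoly_mul_cpow P s)
  have hg0 : g 0 = 0 := by simp [hg, Complex.zero_cpow hs0]
  rw [hg0, sub_zero, hg', integral_add hint1 hint2] at hFTC
  -- identify the two integrals with Mellin transforms
  have e1 : ∫ x in Ioi (0:ℝ), (gaussPoly (derivPoly P) x : ℂ) * (x : ℂ) ^ s =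
      mellin (fun x => (gaussPoly (derivPoly P) x : ℂ)) (s + 1) := by
    rw [mellin]
    refine setIntegral_congr_fun measurableSet_Ioi fun x _ => ?_
    simp [smul_eq_mul, mul_comm]
  have e2 : ∫ x in Ioi (0:ℝ), (gaussPoly P x : ℂ) * (s * (x : ℂ) ^ (s - 1)) =
      s * mellin (fun x => (gaussPoly P x : ℂ)) s := by
    rw [mellin, ← integral_const_mul]
    refine setIntegral_congr_fun measurableSet_Ioi fun x _ => ?_
    simp [smul_eq_mul]; ring
  rw [e1, e2] at hFTC
  linear_combination hFTC

/-! ### The ladder identity and the Mellin recursion -/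

/-- `derivative (derivative He_{m+2}) = (m+2)(m+1)·He_m`. [folklore] -/
private theorem derivative_derivative_hermiteR_add_two (m : ℕ) :
    derivative (derivative (hermiteR (m + 2))) = C (((m + 2) * (m + 1) : ℕ) : ℝ) * hermiteR m := by
  rw [derivative_hermiteR_succ (m + 1), derivative_mul, derivative_C, zero_mul, zero_add,
    derivative_hermiteR_succ m, ← mul_assoc, ← C_mul]
  congr 2
  push_cast; ring

/-- **Ladder identity** (coordinate form of `(xp+px)/2 = (i/2)(a†a†−aa)` on `ψ_n`):
`He_{n+2} = X²·He_n − 2X·He_n' − He_n + He_n''`. [cite: Srednicki2011, §2, ⟨n|H_BK|n'⟩] -/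
theorem hermiteR_add_two_ladder (n : ℕ) :
    hermiteR (n + 2) = X ^ 2 * hermiteR n - 2 * (X * derivative (hermiteR n)) - hermiteR n +
      derivative (derivative (hermiteR n)) := by
  rw [hermiteR_succ (n + 1), hermiteR_succ n, derivative_sub, derivative_mul, derivative_X]
  ring

/-- `-2·X·derivPoly P = X²·P − 2X·P'`, so the ladder identity reads
`He_{n+2} = −2·X·derivPoly(He_n) − He_n + He_n''`. [folklore] -/
private theorem hermiteR_add_two_eq_derivPoly (n : ℕ) :
    hermiteR (n + 2) = -(2 * (X * derivPoly (hermiteR n))) - hermiteR n +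
      derivative (derivative (hermiteR n)) := by
  rw [hermiteR_add_two_ladder, derivPoly]
  have h2 : (2 : ℝ[X]) * C (1 / 2 : ℝ) = 1 := by
    rw [show (2 : ℝ[X]) = C 2 by rfl, ← C_mul]; norm_num
  linear_combination (-(X ^ 2 * hermiteR n)) * h2

/-- `M[x·f'](s) = M[f'](s+1)`: the Mellin transform of `gaussPoly (X * Q)` at `s` is that of
`gaussPoly Q` at `s + 1`. [folklore] -/
private theorem mellin_gaussPoly_X_mul (Q : ℝ[X]) (s : ℂ) :
    mellin (fun x => (gaussPoly (X * Q) x : ℂ)) s = mellin (fun x => (gaussPoly Q x : ℂ)) (s + 1) := by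
  rw [← mellin_cpow_smul]
  congr 1
  funext x
  simp [gaussPoly, smul_eq_mul]
  ring

/-- Convergence of `Φ_n(s)` for `Re s > 0`. [cite: BumpEtAl2000, §1] -/
theorem mellinConvergent_hermiteFun (n : ℕ) {s : ℂ} (hs : 0 < s.re) :
    MellinConvergent (fun x => (hermiteFun n x : ℂ)) s :=
  mellinConvergent_gaussPoly _ hs

/-- **Mellin recursion in steps of two** [cite: Srednicki2011, §2, recursion for φ_{k+1}]:
`Φ_{n+2}(s) = (2s − 1)·Φ_n(s) + M[He_n''·e^{-x²/4}](s)` for `Re s > 0`. -/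
theorem hermiteMellin_add_two (n : ℕ) {s : ℂ} (hs : 0 < s.re) :
    hermiteMellin (n + 2) s = (2 * s - 1) * hermiteMellin n s +
      mellin (fun x => (gaussPoly (derivative (derivative (hermiteR n))) x : ℂ)) s := by
  have hA := mellinConvergent_gaussPoly (X * derivPoly (hermiteR n)) hs
  have hB := mellinConvergent_gaussPoly (hermiteR n) hs
  have hC := mellinConvergent_gaussPoly (derivative (derivative (hermiteR n))) hs
  have hIBP : mellin (fun x => (gaussPoly (X * derivPoly (hermiteR n)) x : ℂ)) s =
      -s * hermiteMellin n s := by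
    rw [mellin_gaussPoly_X_mul, mellin_gaussPoly_deriv _ hs]; rfl
  -- pointwise: ψ_{n+2} = (-2)·gaussPoly(X·D) − ψ_n + gaussPoly(He_n'')
  have hpt : (fun x => (hermiteFun (n + 2) x : ℂ)) = fun x =>
      (((-2 : ℂ) • (gaussPoly (X * derivPoly (hermiteR n)) x : ℂ)) - (gaussPoly (hermiteR n) x : ℂ))
        + (gaussPoly (derivative (derivative (hermiteR n))) x : ℂ) := by
    funext x
    simp only [hermiteFun, gaussPoly, hermiteR_add_two_eq_derivPoly, eval_add, eval_sub, eval_neg,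
      eval_mul, eval_ofNat, smul_eq_mul]
    push_cast
    ring
  have h1 := hasMellin_sub (hA.const_smul (-2 : ℂ)) hB
  have h2 := hasMellin_add h1.1 hC
  rw [hermiteMellin, hpt, h2.2, h1.2, mellin_const_smul, hIBP]
  simp only [hermiteMellin, hermiteFun, smul_eq_mul]
  ring

/-- `Φ_{m+4}(s) = (2s−1)·Φ_{m+2}(s) + (m+2)(m+1)·Φ_m(s)` — the recursion with its lower term
`n(n−1)Φ_{n−2}` for `n = m + 2 ≥ 2`. [cite: Srednicki2011, §2] [cite: BumpEtAl2000, §1] -/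
theorem hermiteMellin_add_four (m : ℕ) {s : ℂ} (hs : 0 < s.re) :
    hermiteMellin (m + 4) s = (2 * s - 1) * hermiteMellin (m + 2) s +
      (((m + 2) * (m + 1) : ℕ) : ℂ) * hermiteMellin m s := by
  rw [show m + 4 = (m + 2) + 2 by ring, hermiteMellin_add_two _ hs,
    derivative_derivative_hermiteR_add_two]
  congr 1
  have : (fun x => (gaussPoly (C (((m + 2) * (m + 1) : ℕ) : ℝ) * hermiteR m) x : ℂ)) =
      fun x => (((m + 2) * (m + 1) : ℕ) : ℂ) • (hermiteFun m x : ℂ) := by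
    funext x
    simp only [gaussPoly, hermiteFun, eval_mul, eval_C, smul_eq_mul]
    push_cast
    ring
  rw [this, mellin_const_smul, smul_eq_mul, hermiteMellin]

/-- `Φ_2(s) = (2s−1)·Φ_0(s)` (`He_0'' = 0`). [cite: BumpEtAl2000, §1] -/
theorem hermiteMellin_two {s : ℂ} (hs : 0 < s.re) :
    hermiteMellin 2 s = (2 * s - 1) * hermiteMellin 0 s := by
  rw [hermiteMellin_add_two 0 hs, hermiteR_zero, derivative_one, derivative_zero]
  simp [gaussPoly, mellin]

/-- `He_1 = X` over `ℝ`. [folklore] -/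
private theorem hermiteR_one : hermiteR 1 = X := by
  rw [hermiteR_succ 0, hermiteR_zero, derivative_one]; simp

/-- `Φ_3(s) = (2s−1)·Φ_1(s)` (`He_1'' = 0`). [cite: BumpEtAl2000, §1] -/
theorem hermiteMellin_three {s : ℂ} (hs : 0 < s.re) :
    hermiteMellin 3 s = (2 * s - 1) * hermiteMellin 1 s := by
  rw [hermiteMellin_add_two 1 hs, hermiteR_one, derivative_X, derivative_one]
  simp [gaussPoly, mellin]

/-! ### The Tate local factors: `Φ_0` and `Φ_1` -/

/-- `Φ_0(s) = ½·(¼)^{-s/2}·Γ(s/2)` for `Re s > 0` (`= 2^{s-1}Γ(s/2)`; BCKV's `Γ_{∞,0}` up to the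
rescaling `x ↦ 2√π x`). [cite: Srednicki2011, §1, Γ_{∞,0}(s) = π^{-s/2}Γ(s/2)] -/
theorem hermiteMellin_zero {s : ℂ} (hs : 0 < s.re) :
    hermiteMellin 0 s = (1 / 2 : ℂ) * (((1 / 4 : ℝ) : ℂ) ^ (-(s / 2)) * Complex.Gamma (s / 2)) := by
  have h1 : (fun x => (hermiteFun 0 x : ℂ)) =
      fun x : ℝ => (fun u : ℝ => ((Real.exp (-((1 / 4) * u)) : ℝ) : ℂ)) (x ^ (2 : ℝ)) := by
    funext x
    show (hermiteFun 0 x : ℂ) = ((Real.exp (-((1 / 4) * x ^ (2 : ℝ))) : ℝ) : ℂ)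
    rw [Real.rpow_two]
    simp only [hermiteFun, gaussPoly, hermiteR_zero, eval_one, one_mul]
    congr 2; ring
  have h2 : mellin (fun u : ℝ => ((Real.exp (-((1 / 4) * u)) : ℝ) : ℂ)) (s / 2) =
      (((1 / 4 : ℝ) : ℂ) ^ (-(s / 2))) • mellin (fun u : ℝ => ((Real.exp (-u) : ℝ) : ℂ)) (s / 2) := by
    rw [← mellin_comp_mul_left _ _ (by norm_num : (0:ℝ) < 1 / 4)]
  have h3 : mellin (fun u : ℝ => ((Real.exp (-u) : ℝ) : ℂ)) (s / 2) = Complex.Gamma (s / 2) := by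
    rw [← Complex.GammaIntegral_eq_mellin, Complex.Gamma_eq_integral]
    simp; linarith
  rw [hermiteMellin, h1, mellin_comp_rpow (fun u : ℝ => ((Real.exp (-((1 / 4) * u)) : ℝ) : ℂ)) s 2,
    show ((2 : ℝ) : ℂ) = 2 by norm_num, h2, h3, smul_eq_mul,
    Complex.real_smul, abs_of_pos (by norm_num : (0:ℝ) < 2)]
  push_cast
  ring

/-- `Φ_0(s) ≠ 0` for `Re s > 0`. [cite: Srednicki2011, §2, "Γ_{∞,0} has no zeros"] -/
theorem hermiteMellin_zero_ne_zero {s : ℂ} (hs : 0 < s.re) : hermiteMellin 0 s ≠ 0 := by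
  rw [hermiteMellin_zero hs]
  refine mul_ne_zero (by norm_num) (mul_ne_zero ?_ (Complex.Gamma_ne_zero_of_re_pos ?_))
  · exact Complex.cpow_ne_zero_iff.mpr (Or.inl (by norm_num))
  · simp; linarith

/-- `Φ_1(s) = Φ_0(s+1)` (`ψ_1 = x·ψ_0`). [cite: Srednicki2011, §2, Γ_{∞,1}] -/
theorem hermiteMellin_one (s : ℂ) : hermiteMellin 1 s = hermiteMellin 0 (s + 1) := by
  rw [hermiteMellin, hermiteMellin, ← mellin_cpow_smul]
  congr 1; funext x
  simp [hermiteFun, gaussPoly, hermiteR_one, hermiteR_zero, smul_eq_mul]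

/-- `Φ_1(s) ≠ 0` for `Re s > 0` (indeed for `Re s > -1`). [cite: Srednicki2011, §2] -/
theorem hermiteMellin_one_ne_zero {s : ℂ} (hs : 0 < s.re) : hermiteMellin 1 s ≠ 0 := by
  rw [hermiteMellin_one]
  exact hermiteMellin_zero_ne_zero (by simp; linarith)

/-! ### Assembly: `Φ_{2K+δ} = Q_K · Φ_δ` and the local Riemann hypothesis on the Mellin side -/

/-- **`Φ_{2K+δ}(s) = Q_K(s)·Φ_δ(s)`** for `δ ∈ {0,1}` and `Re s > 0`: the Mellin transform of the
`(2K+δ)`-th Hermite function is the Hermite–Mellin polynomial times the Tate local factor.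
[cite: BumpEtAl2000, §1, definition of p_n] [cite: Srednicki2011, §2, φ_K = det(…)·φ_0] -/
theorem hermiteMellin_eq_hermiteMellinPoly_mul {δ : ℕ} (hδ : δ ≤ 1) {s : ℂ} (hs : 0 < s.re) :
    ∀ K, hermiteMellin (2 * K + δ) s = aeval s (hermiteMellinPoly δ K) * hermiteMellin δ s
  | 0 => by simp
  | 1 => by
    rw [aeval_hermiteMellinPoly_one]
    interval_cases δ
    · exact hermiteMellin_two hs
    · exact hermiteMellin_three hs
  | (K + 2) => by
    have ih1 := hermiteMellin_eq_hermiteMellinPoly_mul hδ hs (K + 1)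
    have ih0 := hermiteMellin_eq_hermiteMellinPoly_mul hδ hs K
    rw [show 2 * (K + 2) + δ = (2 * K + δ) + 4 by ring, hermiteMellin_add_four _ hs,
      show 2 * K + δ + 2 = 2 * (K + 1) + δ by ring, ih1, ih0, aeval_hermiteMellinPoly_add_two]
    push_cast
    ring

/-- **Zeros of `Φ_n` in `Re s > 0` are exactly the zeros of `Q_{⌊n/2⌋}^{(n mod 2)}`** (the local
factor `Φ_{n mod 2}` does not vanish there). [cite: BumpEtAl2000, Thm 1] [cite: Srednicki2011, §2] -/
theorem hermiteMellin_eq_zero_iff (n : ℕ) {s : ℂ} (hs : 0 < s.re) :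
    hermiteMellin n s = 0 ↔ aeval s (hermiteMellinPoly (n % 2) (n / 2)) = 0 := by
  have hn : 2 * (n / 2) + n % 2 = n := Nat.div_add_mod n 2
  have hδ : n % 2 ≤ 1 := Nat.lt_succ_iff.mp (Nat.mod_lt n two_pos)
  have key := hermiteMellin_eq_hermiteMellinPoly_mul hδ hs (n / 2)
  rw [hn] at key
  have hne : hermiteMellin (n % 2) s ≠ 0 := by
    rcases Nat.mod_two_eq_zero_or_one n with h | h
    · rw [h]; exact hermiteMellin_zero_ne_zero hs
    · rw [h]; exact hermiteMellin_one_ne_zero hs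
  rw [key, mul_eq_zero, or_iff_left hne]

/-- **Local Riemann hypothesis, archimedean place, Mellin form** [cite: BumpEtAl2000, Thm 1]
(spectral proof of [cite: Srednicki2011, §2]): for every `n`, every zero of
`Φ_n(s) = ∫₀^∞ He_n(x) e^{-x²/4} x^{s-1} dx` in the half-plane `Re s > 0` lies on `Re s = 1/2`. -/
theorem re_eq_half_of_hermiteMellin_eq_zero (n : ℕ) {s : ℂ} (hs : 0 < s.re)
    (h : hermiteMellin n s = 0) : s.re = 1 / 2 :=
  hermiteMellinPoly_re_eq_half _ _ ((hermiteMellin_eq_zero_iff n hs).mp h)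

/-- Spectral reading [cite: Srednicki2011, §2]: `Φ_n(s) = 0` with `Re s > 0` iff `s = 1/2 + iE` where
`E = -i(s − 1/2)` is a (real) zero of the characteristic polynomial `P_{⌊n/2⌋}` of the Berry–Keating
Hamiltonian compressed to the `⌊n/2⌋` oscillator levels of parity `n mod 2` below `n`. -/
theorem hermiteMellin_eq_zero_iff_jacobiPoly (n : ℕ) {s : ℂ} (hs : 0 < s.re) :
    hermiteMellin n s = 0 ↔
      aeval (-I * (s - 1 / 2)) (jacobiPoly (hermiteWeight (n % 2)) (n / 2)) = 0 := by
  rw [hermiteMellin_eq_zero_iff n hs, aeval_hermiteMellinPoly_eq_zero_iff]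

end

end LocalRH

end Literature.NumberTheory.LFunctions
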